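import Literature.NumberTheory.Automorphic.UnitaryGroupRestrictedProduct
import Literature.NumberTheory.Automorphic.UnitaryGroupPoints
import Literature.NumberTheory.Automorphic.AdeleBaseChange
import Literature.AlgebraicGeometry.Motives.Varieties
import Literature.AlgebraicGeometry.Motives.WeilTypeCM
import Mathlib.FieldTheory.Galois.Basic
import Mathlib.NumberTheory.NumberField.CMField
import Mathlib.NumberTheory.NumberField.Completion.InfinitePlace
import Mathlib.LinearAlgebra.Matrix.PosDef
import HarnessLib

/-!
# Liu 2021, Appendix C «Shimura varieties for hermitian spaces»: Definition C.1, Remark C.2, Definition C.3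
# — EXACTLY AS PRINTED (statement-exact typing of the objects and data; no proof of any result of [Liu2021])

[Liu2021] = Yifeng Liu, *Fourier–Jacobi cycles and arithmetic relative trace formula* (with an appendix by Chao Li
and Yihang Zhu), Cambridge J. Math. **9** (2021), no. 1, 1–147 = arXiv:2102.11518.  PRIMARY SOURCE READ FOR THIS FILE:
the author's TeX source of the arXiv e-print, `FJcycle.tex` (md5 `6db49a74122d2cb0f224fa1b39488a0c`, 7163 lines; held
at `run/shared/lean/pub/pub-hodgecm/pub-hodgecm-cf-kudla-howe-rallis-g4/lit/Liu21-arxiv-src/FJcycle.tex`) — every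
`l. NNNN` below is a line of that file.  NUMBERING: Appendix C is `\section{Shimura varieties for hermitian spaces}`
(TeX label `ss:c`, l. 4544); all numbered environments of the paper share ONE counter within the section (preamble
l. 48–69: `\newtheorem{proposition}{Proposition}[section]`, `definition`/`remark`/… `[proposition]`), so in App. C:
**C.1** = Definition l. 4565–4567 (reflex field / reduced reflex field) · **C.2** = Remark `re:picard` l. 4602–4609 ·
**C.3** = Definition `de:incoherent_hermitian` l. 4614–4616 · C.4 = Definition `de:nearby` l. 4620–4622 · C.5 =
Proposition `pr:incoherent_shimura` l. 4627–4637 · C.6 = Definition l. 4640 · C.7 = Remark l. 4644 · C.8 = Definition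
l. 4663 · C.9 = Remark l. 4667; the displayed equation **(C.1)** = `eq:signature` l. 4559–4562 (equations are numbered
`\numberwithin{equation}{section}`, l. 48).  Cambridge J. Math. page numbers are not held (acq-07613) and are not quoted.
This file types C.1, C.2, C.3 together with the unnumbered standing text they depend on (l. 4550, l. 4558–4563,
l. 4569–4573, l. 4579–4599, l. 4612, l. 4618).  C.4 / C.5 / C.6–C.9 are the sibling files `DefC4`, `PropC5`, `Glue` of
this directory (coordinator ruling 2026-08-21T16:13:55Z, lead naming ruling 16:14:26Z, `HOME/liuC/NAMES.md`).

## The printed text (verbatim from `FJcycle.tex`; TeX macros resolved: `\rV` = `V`, `\bV` = `𝕍`, `\rG` = `G`, `\bG` = `𝔾`,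
`\bA` = `𝔸`, `\dC` = `ℂ`, `\dQ` = `ℚ`, `\dR` = `ℝ`, `\dN` = `ℕ`, `\tc` = `c`, `\Nm` = `Nm`, `\sig` = `sig`, `\rU` = `U`,
`\rh` = `h`, `\rI` = `I`, `\r{rec}` = `rec`, `\Sh` = `Sh`, `\res` = `|`)

**Preamble of App. C**, l. 4550: «Let `F` be a totally real number field of degree `d ≥ 1`, and `E/F` a totally imaginary
quadratic extension. Denote by `c` the nontrivial involution of `E` over `F`. Denote by `Φ_F` the set of real embeddings
of `F` and by `Φ_E` the set of complex embeddings of `E`. Let `ℕ[Φ_E]` be the commutative monoid freely generated by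
`Φ_E`. The Galois group `Gal(ℂ/ℚ)` acts on `Φ_E`, hence on `ℕ[Φ_E]`. We have the projection map `π : Φ_E → Φ_F` given by
restriction. Recall that a CM type (of `E`) is a subset `Φ` of `Φ_E` such that `π` induces a bijection from `Φ` to `Φ_F`.
For a CM type `Φ`, put `Φ^c := Φ_E ∖ Φ`, which is again a CM type.»

**§C.1 «Case of isometry», standing data**, l. 4558–4563: «Let `V` be a (non-degenerate) hermitian space over `E`
(with respect to `c`) of rank `n ≥ 1`, with the hermitian form `( , )_V : V × V → E` that is `E`-linear in the first
variable. For every `τ ∈ Φ_F`, let `(p_τ, q_τ)` be the signature of `V ⊗_{F,τ} ℝ`. We take a CM type `Φ ⊆ Φ_E`. Then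
we have two elements
  (C.1)  `sig_{V,Φ} := Σ_{τ ∈ Φ_F} p_τ τ^+ + Σ_{τ ∈ Φ_F} q_τ τ^-`,  `sig^♭_{V,Φ} := Σ_{τ ∈ Φ_F} q_τ τ^-`
in `ℕ[Φ_E]`. Here, `τ^-` (resp. `τ^+`) is the unique element in `Φ` (resp. `Φ^c`) whose image under `π` is `τ`.»

**DEFINITION C.1** (l. 4565–4567), VERBATIM: «We define the *reflex field* (resp. *reduced reflex field*) of the pair
`(V, Φ)` to be the fixed field of the stabilizer in `Gal(ℂ/ℚ)` of the element `sig_{V,Φ}` (resp. `sig^♭_{V,Φ}`), denoted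
by `E_{V,Φ}` (resp. `E^♭_{V,Φ}`).»

l. 4569–4573: «Let `U(V)` be the unitary group (of isometry) of `V`, that is, the reductive group over `F` such that for
every `F`-algebra `R`, we have `U(V)(R) = {g ∈ GL_R(V ⊗_F R) | (gx, gy)_V = (x, y)_V for all x, y ∈ V ⊗_F R}`.  For
every `τ ∈ Φ_F`, we may identify `V ⊗_{E,τ^-} ℂ` with `ℂ^{⊕n}`, hence `U(V) ⊗_{F,τ} ℝ` is identified with the subgroup
of `Res_{ℂ/ℝ} GL_n` of elements preserving the hermitian form given by the matrix `diag(I_{p_τ}, −I_{q_τ})`.»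

l. 4579–4599: «Put `G := Res_{F/ℚ} U(V)`. We define the Hodge map `h^♭_{V,Φ} : Res_{ℂ/ℝ} 𝔾_m → G_ℝ` to be the one sending
`z ∈ ℂ^× = (Res_{ℂ/ℝ} 𝔾_m)(ℝ)` to `(diag(I_{p_{τ_1}}, (z/\bar z) I_{q_{τ_1}}), …, diag(I_{p_{τ_d}}, (z/\bar z) I_{q_{τ_d}}))
∈ G_ℝ(ℝ)`, where we identify `G_ℝ(ℝ)` as a subgroup of `GL_n(ℂ)^d` via `{τ_1^-, …, τ_d^-}`. Then we obtain a Shimura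
data `(G, h^♭_{V,Φ})`. It is of abelian type but not Hodge type; and its reflex field coincides with `E^♭_{V,Φ}`. The theory
of Shimura varieties provides us with a projective system of schemes `{Sh(G, h^♭_{V,Φ})_K}_K`, quasi-projective and
smooth over `E^♭_{V,Φ}` of dimension `Σ_{τ ∈ Φ_F} p_τ q_τ`, indexed by neat open compact subgroups `K` of
`G(𝔸^∞) = U(V)(𝔸_F^∞)`.»

**REMARK C.2** (TeX label `re:picard`, l. 4602–4609), VERBATIM: «Suppose that there is an element `τ ∈ Φ_F` such that `V`
has signature `(n−1, 1)` at `τ` and `(n, 0)` at other places. Then the Hodge map `h^♭_{V,Φ}` hence the Shimura variety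
`Sh(G, h^♭_{V,Φ})_K` depend only on `Φ ∩ π^{−1}τ`, that is, the unique element contained in `Φ` above `τ`. Thus, for an
element `τ' ∈ Φ_E` above `τ`, we may write `h_{V,τ'}` and `Sh(G, h_{V,τ'})_K` for those `Φ` containing `τ'`. In
particular, the reflex field of `h_{V,τ'}` is `τ'(E)`. The Galois group `Gal(ℂ/τ'(E))` acts on the set of connected
components of `Sh(G, h_{V,τ'})_K ⊗_{ι'(E)} ℂ` via the composite homomorphism
`Gal(ℂ/τ'(E)) —rec→ τ'(E)^× \ (𝔸^∞_{τ'(E)})^× —(τ')^{−1}→ E^× \ (𝔸_E^∞)^× —(e ↦ e/e^c)→ E^1 \ (𝔸_E^∞)^1`,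
where `rec` is the global reciprocity map for the number field `τ'(E)`.» (`ι'(E)` sic in the source, = `τ'(E)`.)

l. 4612: «Now we would like to attach Shimura varieties to an incoherent hermitian space, a concept originated from [KR94]
in the orthogonal case and explored in [Zha19]. […]»

**DEFINITION C.3** (TeX label `de:incoherent_hermitian`, l. 4614–4616), VERBATIM: «An *incoherent hermitian space* over
`𝔸_E` is a free `𝔸_E`-module `𝕍` of some rank `n ≥ 1`, equipped with a non-degenerate hermitian form
`( , )_𝕍 : 𝕍 × 𝕍 → 𝔸_E` with respect to the (induced) involution `c` on `𝔸_E` such that its determinant belongs to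
`𝔸_F^× ∖ F^× Nm_{𝔸_E/𝔸_F} 𝔸_E^×`. We say that `𝕍` is totally positive definite if for every `τ ∈ Φ_F`, `𝕍 ⊗_{𝔸_F,τ} ℝ`
is positive definite.»

l. 4618: «Let `𝕍` be a totally positive definite incoherent hermitian space over `𝔸_E` of rank `n ≥ 1`, and let
`𝔾 := U(𝕍)` be its group of isometry, which is a reductive group over `𝔸_F`.»

## How the printed objects are typed (paper order).  REAL = a genuine Mathlib / tree object; ⟨CARRIER⟩ = posited datum
## standing for a printed object Mathlib and the tree cannot construct (same discipline as `Thm418Data`; nothing is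
## asserted by a carrier).  READINGS R1–R9 are the only interpretive choices; none adds or removes a printed condition.

* `F`, `E` (l. 4550 = l. 1878): the standing binders of `Thm418Data`, copied verbatim:
  `[Field F] [NumberField F] [IsTotallyReal F] [Field E] [NumberField E] [Algebra F E] [IsTotallyComplex E]
  [Algebra.IsQuadraticExtension F E]`.  REAL.
* `c` = `conj F E : E ≃ₐ[F] E` (l. 4550 «the nontrivial involution of `E` over `F`»): Mathlib's complex conjugation
  `NumberField.IsCMField.complexConj E` of the CM field `E` (`IsCMField E` by Mathlib `IsCMField.ofCMExtension F E`; = READING R1 of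
  the sibling file `Thm418AsPrinted`), repackaged as an `F`-algebra automorphism (`conj_apply`; it fixes `F`: `complexConj_algebraMap`);
  characterised by `φ (c x) = \overline{φ x}` for every complex embedding `φ` (`complexEmbedding_conj`) and `c ≠ 1`
  (`conj_ne_one`).  REAL.
* `Φ_F` = `F →+* ℝ`, `Φ_E` = `E →+* ℂ` (l. 4550).  `ℕ[Φ_E]` = `(E →+* ℂ) →₀ ℕ` (finitely supported functions = the free
  commutative monoid on `Φ_E`; READING R2, the standard model).  `Gal(ℂ/ℚ)` = `ℂ ≃ₐ[ℚ] ℂ` (Liu's `Gal(ℂ/k)` for a subfield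
  `k ⊆ ℂ` is the automorphism group `Aut(ℂ/k)`, as in `Thm418AsPrinted` READING R4), acting on `Φ_E` by `σ · φ := σ ∘ φ`
  (`galAct`) «hence on `ℕ[Φ_E]`» by push-forward (`galActElt`, `Finsupp.mapDomain`) — both as (scoped) `MulAction`s — and `stabilizer s ≤ Gal(ℂ/ℚ)` = Mathlib's
  `MulAction.stabilizer`.  REAL.
* `π : Φ_E → Φ_F` «given by restriction» = `restr F E φ : F →+* ℝ` (the restriction `φ ∘ (F → E)` is a real embedding
  because `F` is totally real, Mathlib `IsTotallyReal.complexEmbedding_isReal`; `restr_apply_coe`).  REAL.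
  CM types: the tree's `Literature.AlgebraicGeometry.Motives.CMType E` (a set `Φ` of complex embeddings containing exactly
  one of each complex-conjugate pair) — for the CM extension `E/F` this is the printed «`π` induces a bijection from `Φ`
  to `Φ_F`» (the fibre of `π` over `τ` is a conjugate pair); READING R3 = reuse of the tree notion, as in `Thm418Data.cmType`.
  `Φ^c := Φ_E ∖ Φ` = `CMType.conj Φ` (REAL, with the proof that it is again a CM type).  `τ^-` = `CMType.above Φ τ`, `τ^+` =
  `CMType.aboveConj Φ τ` («the unique element in `Φ` (resp. `Φ^c`) whose image under `π` is `τ`», l. 4563), selected by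
  `Classical.epsilon` on exactly that printed property (their specification lemmas are bookkeeping for the companion
  file `DefC1toC3Aux`; nothing below depends on them being proved).
* «hermitian space `V` over `E` … of rank `n ≥ 1` … `E`-linear in the first variable» (l. 4558) = `structure HermSpace F E`:
  REAL — an `E`-vector space `V` with `finrank E V = n`, `1 ≤ n`, a form `form : V → V → E`, additive and `E`-linear in the
  FIRST variable (`form_add_left`, `form_smul_left`), hermitian `(y, x) = c((x, y))` (`form_herm`), non-degenerate
  (`form_nondeg`).  Coordinates: `HermSpace.basis` (a basis `e_1, …, e_n`, which exists), `HermSpace.gram` = the matrix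
  `J` with `J i j = (e_j, e_i)_V`, so that `(x, y)_V = \bar yᵀ J x` in coordinates and the isometry condition reads
  `(c g)ᵀ J g = J` — the tree's convention `unitaryGroupOfForm` / `UnitaryScheme.points` (READING R4: a choice of basis;
  every printed notion below is basis-invariant).
* «`(p_τ, q_τ)` the signature of `V ⊗_{F,τ} ℝ`» (l. 4558) = `HermSpace.sig V τ : ℕ × ℕ`, REAL: `p_τ` (resp. `q_τ`) = the
  largest dimension of an `E`-subspace `W ≤ V` on which `(x, x)_V` is `τ`-positive (resp. `τ`-negative) for all `x ≠ 0`
  (READING R5: the signature of the real-ified hermitian form = maximal dimension of a positive / negative definite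
  subspace, and `E`-rational subspaces suffice; `τ`-positivity of the `c`-invariant element `(x, x)_V ∈ F` is read through
  `τ (Tr_{E/F} (x, x)_V) = 2 τ((x, x)_V)`).
* (C.1): `HermSpace.sigElt V Φ`, `HermSpace.sigFlatElt V Φ : (E →+* ℂ) →₀ ℕ`, written exactly as the printed sums.  REAL.
* **Def. C.1**: `HermSpace.reflexField V Φ`, `HermSpace.reducedReflexField V Φ : IntermediateField ℚ ℂ` = the fixed field
  (Mathlib `IntermediateField.fixedField`) of `stabilizer (sigElt V Φ)` (resp. `stabilizer (sigFlatElt V Φ)`).  REAL.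
* `U(V)` (l. 4569–4571) = `HermSpace.unitaryGroup V R ≤ GL_n(E ⊗_F R)`, the `R`-points for an `F`-algebra `R`, and
  `HermSpace.unitaryGroupFunctor V : CommAlgCat F ⥤ GrpCat`, its functor of points — the tree's `UnitaryScheme.points` /
  `UnitaryScheme.functor` at `(c, J)` (READING R4; `GL_R(V ⊗_F R) = GL_n(E ⊗_F R)` by the basis).  REAL.  Reductivity is a
  printed attribute not used by any later sentence typed here and is not typed.
* `G := Res_{F/ℚ} U(V)` (l. 4579) = `HermSpace.resPoints V A := U(V)(F ⊗_ℚ A)` for a `ℚ`-algebra `A` (Weil restriction,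
  by its functor of points).  `G(𝔸^∞) = U(V)(𝔸_F^∞)` (l. 4599) = `HermSpace.Gfin V ≤ GL_n(𝔸_E^∞)`, the tree's
  `UnitaryGroup.finAdelic` (READING R6: `E ⊗_F 𝔸_F^∞ = 𝔸_E^∞`, the standard identification, as in the tree file
  `UnitaryGroupPoints`), a topological group.  REAL.
* The Hodge map `h^♭_{V,Φ}` (l. 4579–4598) = `HermSpace.hodgeMapFlat V z τ`, REAL as the printed tuple of matrices
  `diag(I_{p_τ}, (z/\bar z) I_{q_τ})` indexed by `τ ∈ Φ_F` (= by `{τ_1^-, …, τ_d^-}`), in the printed coordinates of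
  l. 4573 (`V ⊗_{E,τ^-} ℂ = ℂ^{⊕n}` with form `diag(I_{p_τ}, −I_{q_τ})`); the identification itself is the printed one
  and is not constructed (READING R7).
* «Shimura data `(G, h^♭_{V,Φ})` … projective system of schemes `{Sh(G, h^♭_{V,Φ})_K}_K`, quasi-projective and smooth over
  `E^♭_{V,Φ}` of dimension `Σ p_τ q_τ`, indexed by neat open compact subgroups `K` of `G(𝔸^∞)`» (l. 4599): no Shimura
  varieties exist in Mathlib / the tree ⇒ ⟨CARRIER⟩ `structure HermSpace.ShimuraSystemFlat V Φ`: a projective system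
  `Sh K` of schemes over the REAL field `E^♭_{V,Φ}` (tree `SchemeOver`), indexed by subgroups `K ≤ G(𝔸^∞)` (REAL group),
  with the printed attributes as `Prop` fields over REAL predicates (`IsQuasiProjectiveOver`, Mathlib
  `SmoothOfRelativeDimension`, open / compact in the topological group `G(𝔸^∞)`) and neatness as a ⟨CARRIER⟩ predicate `IsNeat` (Liu does not define
  «neat»; READING R8).  «of abelian type but not Hodge type» and «its reflex field coincides with `E^♭_{V,Φ}`» are printed
  CLAIMS about the datum, recorded here, not typed (no Shimura-datum vocabulary exists to state them on).
* **Rem. C.2**: the hypothesis «signature `(n−1,1)` at `τ` and `(n,0)` at other places» = `HermSpace.IsSignatureN1At V τ`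
  (REAL); the notation `Sh(G, h_{V,τ'})_K` for `τ' ∈ Φ_E` above `τ` = ⟨CARRIER⟩ `structure HermSpace.ShimuraSystem V τ'`
  (same shape as `ShimuraSystemFlat`, hypothesis field `sig_eq`, schemes over `E` — READING R9: «schemes over `τ'(E)`»,
  `τ' : E ≃ τ'(E)`; dimension `n − 1 = Σ p_τ q_τ` here), and `HermSpace.hodgeMap V τ' z` = `h_{V,τ'}` (the `τ`-component
  `diag(I_{n−1}, z/\bar z)`; REAL).  NOT TYPED (recorded verbatim above, no carrier posited): the dependence claim «depend
  only on `Φ ∩ π^{−1}τ`», the claim «the reflex field of `h_{V,τ'}` is `τ'(E)`», and the description of the Galois action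
  on `π_0(Sh(G, h_{V,τ'})_K ⊗ ℂ)` through `rec` and `e ↦ e/e^c` (class field theory for `τ'(E)` and `π_0` of a carrier
  scheme are not available to state it on; a consumer needing it posits it on its own datum and cites l. 4603–4608).
* **Def. C.3** = `structure IncoherentHermSpace F E`: REAL on Mathlib's adèle ring `𝔸_E = AdeleRing (𝓞 E) E` — a module
  `𝕍` over `𝔸_E` with a basis indexed by `Fin n` («free `𝔸_E`-module of some rank `n ≥ 1`»; the basis is carried as data,
  READING R4), a form `form : 𝕍 → 𝕍 → 𝔸_E` additive and `𝔸_E`-linear in the first variable, hermitian for «the (induced)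
  involution `c` on `𝔸_E`» = the tree's `UnitaryGroup.conjAdele F E c` (`c ⊗ 1` on `𝔸_E = E ⊗_F 𝔸_F`), non-degenerate
  (`form_nondeg`: the Gram determinant is a unit — the meaning of non-degeneracy over the ring `𝔸_E`), and the two halves
  of «its determinant belongs to `𝔸_F^× ∖ F^× Nm_{𝔸_E/𝔸_F} 𝔸_E^×`»: `det_mem` (the Gram determinant is the image of an
  idèle of `F` under the tree's `AdeleRing.baseChange F E : 𝔸_F → 𝔸_E`) and `det_not_mem` (it is not of the form
  `f · z · c(z)`, `f ∈ F^×`, `z ∈ 𝔸_E^×`; `Nm_{𝔸_E/𝔸_F} z = z c(z)`, compared inside `𝔸_E` along the injective base change,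
  `f` embedded by `F → E → 𝔸_E`).  «totally positive definite» = `IncoherentHermSpace.IsTotallyPositiveDefinite 𝕍`: for
  every `τ ∈ Φ_F` and the infinite place `w` of `E` above `τ`, the `w`-component of the Gram matrix, read in `ℂ` through
  Mathlib's `InfinitePlace.Completion.extensionEmbedding w : E_w → ℂ`, is positive definite (Mathlib `Matrix.PosDef`) —
  this is `𝕍 ⊗_{𝔸_F,τ} ℝ` («`= 𝕍_w`, a hermitian space over `E_w ≅ ℂ`») being positive definite (READING R5').
* l. 4618: `𝔾 := U(𝕍)`: its `𝔸_F`-points `IncoherentHermSpace.Gadelic 𝕍 ≤ GL_n(𝔸_E)` and its finite-adèlic points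
  `𝔾(𝔸_F^∞)` = `IncoherentHermSpace.Gfin 𝕍 ≤ GL_n(𝔸_E^∞)` (the tree's `unitaryGroupOfForm` for `c ⊗ 1` and the Gram
  matrix; topological groups).  REAL.  Reductivity over `𝔸_F`: printed attribute, not typed.

T5: n/a (definitions and structures only; no theorem with ≥ 2 hypothesis binders).  Nothing in this file is a claim that
any statement of [Liu2021] holds; HC_CM is not addressed here.

## References

* [Liu2021] Y. Liu, *Fourier–Jacobi cycles and arithmetic relative trace formula*, Camb. J. Math. 9 (2021) 1–147,
  arXiv:2102.11518 — App. C preamble l. 4550; §C.1 l. 4558–4599; Def. C.1 (l. 4565–4567); Rem. C.2 (l. 4602–4609);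
  Def. C.3 (l. 4614–4616); l. 4618.
* [KR94] S. Kudla, M. Rapoport, *Arithmetic Hirzebruch–Zagier cycles*, and [Zha19], [Gro] as cited at l. 4612 / l. 4636
  (attributions printed by Liu; not read for this file).
-/

noncomputable section

open NumberField TensorProduct CategoryTheory AlgebraicGeometry
open scoped Matrix MatrixGroups ComplexOrder
open Literature.AlgebraicGeometry.Motives (CMType SchemeOver IsProjectiveOver)

namespace Literature.NumberTheory.Automorphic.Liu2021.AppendixC

variable (F E : Type) [Field F] [NumberField F] [IsTotallyReal F] [Field E] [NumberField E] [Algebra F E]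
  [IsTotallyComplex E] [Algebra.IsQuadraticExtension F E]

/-! ## Preamble of App. C (l. 4550): `c`, `Φ_F`, `Φ_E`, `ℕ[Φ_E]`, the `Gal(ℂ/ℚ)`-action, `π`, CM types, `Φ^c`, `τ^±` -/

omit [NumberField F] in
/-- Complex conjugation of the CM field `E` fixes `F` (the image of `F` is the maximal real subfield `E⁺`, Mathlib
`CMExtension.equivMaximalRealSubfield`). Our bookkeeping for `conj`. [cite: Liu2021, App. C l. 4550] -/
theorem complexConj_algebraMap (a : F) :
    (letI : IsCMField E := IsCMField.ofCMExtension F E; IsCMField.complexConj E (algebraMap F E a)) = algebraMap F E a := by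
  letI : IsCMField E := IsCMField.ofCMExtension F E
  have h : ((CMExtension.equivMaximalRealSubfield F E a : maximalRealSubfield E) : E) = algebraMap F E a :=
    CMExtension.equivMaximalRealSubfield_apply F E a
  rw [← h]
  exact IsCMField.complexConj_apply_eq_self (K := E) _

/-- **`c`, «the nontrivial involution of `E` over `F`»** (l. 4550): Mathlib's complex conjugation
`IsCMField.complexConj E` of the CM field `E` (READING R1), as an `F`-algebra automorphism of `E`.
[cite: Liu2021, App. C l. 4550] -/
def conj : E ≃ₐ[F] E :=
  letI : IsCMField E := IsCMField.ofCMExtension F E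
  { (IsCMField.complexConj E).toRingEquiv with commutes' := complexConj_algebraMap F E }

omit [NumberField F] in
/-- `conj F E` is Mathlib's `IsCMField.complexConj E` as a function. [cite: Liu2021, App. C l. 4550] -/
theorem conj_apply (x : E) :
    conj F E x = (letI : IsCMField E := IsCMField.ofCMExtension F E; IsCMField.complexConj E x) := rfl

omit [NumberField F] in
/-- `c` IS complex conjugation: `φ (c x) = \overline{φ x}` for every complex embedding `φ ∈ Φ_E`
(Mathlib `IsCMField.complexEmbedding_complexConj`). [cite: Liu2021, App. C l. 4550] -/
theorem complexEmbedding_conj (φ : E →+* ℂ) (x : E) : φ (conj F E x) = starRingEnd ℂ (φ x) := by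
  letI : IsCMField E := IsCMField.ofCMExtension F E
  rw [conj_apply]
  exact IsCMField.complexEmbedding_complexConj E φ x

omit [NumberField F] in
/-- `c` is «nontrivial» (l. 4550). [cite: Liu2021, App. C l. 4550] -/
theorem conj_ne_one : conj F E ≠ 1 := by
  letI : IsCMField E := IsCMField.ofCMExtension F E
  intro h
  apply IsCMField.complexConj_ne_one (K := E)
  ext x
  have := congrArg (fun f : E ≃ₐ[F] E => f x) h
  simpa [conj_apply] using this

/-- **`π : Φ_E → Φ_F` «given by restriction»** (l. 4550): the restriction of a complex embedding `φ` of `E` to `F` is a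
real embedding, `F` being totally real (Mathlib `IsTotallyReal.complexEmbedding_isReal`, `ComplexEmbedding.IsReal.embedding`).
[cite: Liu2021, App. C l. 4550] -/
def restr (φ : E →+* ℂ) : F →+* ℝ :=
  (IsTotallyReal.complexEmbedding_isReal (φ.comp (algebraMap F E))).embedding

omit [NumberField F] [NumberField E] [IsTotallyComplex E] [Algebra.IsQuadraticExtension F E] in
/-- `π φ` is `φ` on `F`: `((π φ) x : ℂ) = φ x`. [cite: Liu2021, App. C l. 4550] -/
theorem restr_apply_coe (φ : E →+* ℂ) (x : F) : ((restr F E φ x : ℝ) : ℂ) = φ (algebraMap F E x) :=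
  ComplexEmbedding.IsReal.coe_embedding_apply _ x

omit [NumberField F] [NumberField E] [IsTotallyComplex E] [Algebra.IsQuadraticExtension F E] in
/-- `π` is «the projection map given by restriction» (l. 4550): `φ ∘ (F → E) = (ℝ → ℂ) ∘ π φ` as ring maps — the
bridge to the sibling `AppendixC.C5.IsAbove τ φ` of `PropC5.lean` («`τ' ∈ Φ_E` above `τ`», l. 4628), which is
`φ.comp (algebraMap F E) = Complex.ofRealHom.comp τ`, i.e. `π φ = τ`. [cite: Liu2021, App. C l. 4550] -/
theorem comp_algebraMap_eq_restr (φ : E →+* ℂ) : φ.comp (algebraMap F E) = Complex.ofRealHom.comp (restr F E φ) := by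
  ext x
  simp [restr_apply_coe]

/-- **The action of `Gal(ℂ/ℚ)` on `Φ_E`** (l. 4550: «The Galois group `Gal(ℂ/ℚ)` acts on `Φ_E`»): `σ · φ := σ ∘ φ`,
`Gal(ℂ/ℚ)` = `ℂ ≃ₐ[ℚ] ℂ`. [cite: Liu2021, App. C l. 4550] -/
def galAct (σ : ℂ ≃ₐ[ℚ] ℂ) (φ : E →+* ℂ) : E →+* ℂ := (σ : ℂ →+* ℂ).comp φ

/-- «hence on `ℕ[Φ_E]`» (l. 4550): the induced action on the free commutative monoid `ℕ[Φ_E]` = `(E →+* ℂ) →₀ ℕ`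
(push-forward of finitely supported functions, `Σ n_φ [φ] ↦ Σ n_φ [σ ∘ φ]`; READING R2). [cite: Liu2021, App. C l. 4550] -/
def galActElt (σ : ℂ ≃ₐ[ℚ] ℂ) (s : (E →+* ℂ) →₀ ℕ) : (E →+* ℂ) →₀ ℕ := Finsupp.mapDomain (galAct E σ) s

omit [NumberField E] [IsTotallyComplex E] in
/-- `1 ∈ Gal(ℂ/ℚ)` acts trivially on `Φ_E`. [cite: Liu2021, App. C l. 4550] -/
theorem galAct_one : galAct E 1 = id := by
  funext φ; ext x; rfl

omit [NumberField E] [IsTotallyComplex E] in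
/-- The action on `Φ_E` is multiplicative. [cite: Liu2021, App. C l. 4550] -/
theorem galAct_mul (σ τ : ℂ ≃ₐ[ℚ] ℂ) : galAct E (σ * τ) = galAct E σ ∘ galAct E τ := by
  funext φ; ext x; rfl

omit [NumberField E] [IsTotallyComplex E] in
/-- `1` acts trivially on `ℕ[Φ_E]`. [cite: Liu2021, App. C l. 4550] -/
theorem galActElt_one (s : (E →+* ℂ) →₀ ℕ) : galActElt E 1 s = s := by
  simp [galActElt, galAct_one, Finsupp.mapDomain_id]

omit [NumberField E] [IsTotallyComplex E] in
/-- The action on `ℕ[Φ_E]` is multiplicative. [cite: Liu2021, App. C l. 4550] -/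
theorem galActElt_mul (σ τ : ℂ ≃ₐ[ℚ] ℂ) (s : (E →+* ℂ) →₀ ℕ) :
    galActElt E (σ * τ) s = galActElt E σ (galActElt E τ s) := by
  simp [galActElt, galAct_mul, Finsupp.mapDomain_comp]

/-- «The Galois group `Gal(ℂ/ℚ)` acts on `Φ_E`» (l. 4550) as a `MulAction` of `ℂ ≃ₐ[ℚ] ℂ` on `E →+* ℂ`, `σ • φ = σ ∘ φ`
(= `galAct`).  Scoped to this namespace (the tree keeps composition actions on embeddings scoped, cf.
`ComplexMultiplication.EmbeddingAction.algEquivCompAction` on `K →ₐ[F] Ω`). [cite: Liu2021, App. C l. 4550] -/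
scoped instance instMulActionGalEmb : MulAction (ℂ ≃ₐ[ℚ] ℂ) (E →+* ℂ) where
  smul σ φ := galAct E σ φ
  one_smul φ := by
    change galAct E 1 φ = φ
    rw [galAct_one]; rfl
  mul_smul σ τ φ := by
    change galAct E (σ * τ) φ = galAct E σ (galAct E τ φ)
    rw [galAct_mul]; rfl

/-- «hence on `ℕ[Φ_E]`» (l. 4550) as a `MulAction` of `ℂ ≃ₐ[ℚ] ℂ` on `(E →+* ℂ) →₀ ℕ`, `σ • s = galActElt σ s`
(push-forward).  Scoped. [cite: Liu2021, App. C l. 4550] -/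
scoped instance instMulActionGalElt : MulAction (ℂ ≃ₐ[ℚ] ℂ) ((E →+* ℂ) →₀ ℕ) where
  smul σ s := galActElt E σ s
  one_smul s := galActElt_one E s
  mul_smul σ τ s := galActElt_mul E σ τ s

omit [NumberField E] [IsTotallyComplex E] in
/-- `σ • φ = σ ∘ φ` on `Φ_E`. [cite: Liu2021, App. C l. 4550] -/
theorem gal_smul_emb_def (σ : ℂ ≃ₐ[ℚ] ℂ) (φ : E →+* ℂ) : σ • φ = galAct E σ φ := rfl

omit [NumberField E] [IsTotallyComplex E] in
/-- `σ • s = galActElt σ s` on `ℕ[Φ_E]`. [cite: Liu2021, App. C l. 4550] -/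
theorem gal_smul_elt_def (σ : ℂ ≃ₐ[ℚ] ℂ) (s : (E →+* ℂ) →₀ ℕ) : σ • s = galActElt E σ s := rfl

/-- **«the stabilizer in `Gal(ℂ/ℚ)` of the element» `s ∈ ℕ[Φ_E]`** (Def. C.1, l. 4566): Mathlib's `MulAction.stabilizer`
for the action above, a subgroup of `ℂ ≃ₐ[ℚ] ℂ`. [cite: Liu2021, Def. C.1 (l. 4566)] -/
abbrev stabilizer (s : (E →+* ℂ) →₀ ℕ) : Subgroup (ℂ ≃ₐ[ℚ] ℂ) := MulAction.stabilizer (ℂ ≃ₐ[ℚ] ℂ) s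

omit [NumberField E] [IsTotallyComplex E] in
/-- Membership in the stabilizer: `σ · s = s`. [cite: Liu2021, Def. C.1 (l. 4566)] -/
theorem mem_stabilizer_iff (s : (E →+* ℂ) →₀ ℕ) (σ : ℂ ≃ₐ[ℚ] ℂ) :
    σ ∈ stabilizer E s ↔ galActElt E σ s = s := MulAction.mem_stabilizer_iff

/-- **`Φ^c := Φ_E ∖ Φ`, «which is again a CM type»** (l. 4550), on the tree's `CMType E` (READING R3): the complement of
a CM type contains exactly one of each conjugate pair (proved here). [cite: Liu2021, App. C l. 4550] -/
def CMType.conj (Φ : CMType E) : CMType E :=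
  ⟨Φ.1ᶜ, fun φ => by
    simp only [Set.mem_compl_iff, not_not]
    rw [Φ.2 φ]
    exact not_not⟩

omit [NumberField E] [IsTotallyComplex E] in
/-- `φ ∈ Φ^c ↔ φ ∉ Φ`. [cite: Liu2021, App. C l. 4550] -/
theorem CMType.mem_conj_iff (Φ : CMType E) (φ : E →+* ℂ) : φ ∈ (CMType.conj E Φ).1 ↔ φ ∉ Φ.1 := Iff.rfl

/-- **`τ^-`, «the unique element in `Φ` whose image under `π` is `τ`»** (l. 4563), for a CM type `Φ` and `τ ∈ Φ_F`:
selected by `Classical.epsilon` on exactly the printed property `φ ∈ Φ ∧ π φ = τ` (existence and uniqueness for the CM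
extension `E/F` are bookkeeping lemmas of the companion file `DefC1toC3Aux`). [cite: Liu2021, App. C l. 4563] -/
def CMType.above (Φ : CMType E) (τ : F →+* ℝ) : E →+* ℂ :=
  Classical.epsilon fun φ : E →+* ℂ => φ ∈ Φ.1 ∧ restr F E φ = τ

/-- **`τ^+`, «the unique element in `Φ^c` whose image under `π` is `τ`»** (l. 4563), selected by `Classical.epsilon` on
the printed property `φ ∈ Φ^c ∧ π φ = τ`. [cite: Liu2021, App. C l. 4563] -/
def CMType.aboveConj (Φ : CMType E) (τ : F →+* ℝ) : E →+* ℂ :=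
  Classical.epsilon fun φ : E →+* ℂ => φ ∈ (CMType.conj E Φ).1 ∧ restr F E φ = τ

/-! ## §C.1 standing data (l. 4558): hermitian spaces over `E` -/

/-- The matrix `diag(I_p, w I_q)` on `ℂ^{⊕(p+q)}` (first `p` diagonal entries `1`, last `q` entries `w`).
[cite: Liu2021, App. C l. 4583–4598] -/
def diagPQ (p q : ℕ) (w : ℂ) : Matrix (Fin (p + q)) (Fin (p + q)) ℂ :=
  Matrix.diagonal (Fin.append (fun _ : Fin p => (1 : ℂ)) (fun _ : Fin q => w))

/-- A `k`-scheme is quasi-projective over `k`: it admits an open `k`-immersion into a projective `k`-scheme (tree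
`IsProjectiveOver` = closed immersion into some `ℙ^N_k`) — Hartshorne's definition (II.4, p. 103: «quasi-projective … if
it factors into an open immersion followed by a projective morphism»). REAL predicate used for the printed attribute
«quasi-projective» of l. 4599 / l. 4656. [cite: Hartshorne1977, II.4 Definition p. 103 (quasi-projective morphism)] -/
def IsQuasiProjectiveOver {k : Type} [Field k] (X : SchemeOver k) : Prop :=
  ∃ (Y : SchemeOver k) (j : X ⟶ Y), IsOpenImmersion j.left ∧ IsProjectiveOver Y


/-- **«a (non-degenerate) hermitian space over `E` (with respect to `c`) of rank `n ≥ 1`, with the hermitian form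
`( , )_V : V × V → E` that is `E`-linear in the first variable»** (l. 4558).  REAL: an `E`-vector space of dimension
`n ≥ 1` with a form that is additive and `E`-linear in the first variable, hermitian with respect to `c = conj F E`
(`(y, x)_V = c((x, y)_V)`, hence `c`-antilinear in the second variable) and non-degenerate.  Nothing is asserted.
[cite: Liu2021, App. C l. 4558] -/
structure HermSpace : Type 1 where
  /-- The underlying `E`-vector space `V`. -/
  V : Type
  [instAddCommGroup : AddCommGroup V]
  [instModule : Module E V]
  /-- «of rank `n`» (l. 4558). -/
  n : ℕ
  /-- «`n ≥ 1`» (l. 4558). -/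
  one_le_n : 1 ≤ n
  /-- `V` has rank `n`: `dim_E V = n` (l. 4558). -/
  finrank_eq : Module.finrank E V = n
  /-- «the hermitian form `( , )_V : V × V → E`» (l. 4558). -/
  form : V → V → E
  /-- additivity in the first variable (part of «`E`-linear in the first variable», l. 4558). -/
  form_add_left : ∀ x y z : V, form (x + y) z = form x z + form y z
  /-- «`E`-linear in the first variable» (l. 4558). -/
  form_smul_left : ∀ (a : E) (x y : V), form (a • x) y = a * form x y
  /-- «hermitian … (with respect to `c`)» (l. 4558): `(y, x)_V = c((x, y)_V)`. -/
  form_herm : ∀ x y : V, form y x = conj F E (form x y)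
  /-- «non-degenerate» (l. 4558): the left kernel is trivial. -/
  form_nondeg : ∀ x : V, (∀ y : V, form x y = 0) → x = 0

attribute [instance] HermSpace.instAddCommGroup HermSpace.instModule

namespace HermSpace

variable {F E}
variable (V : HermSpace F E)

/-- `V` is finite-dimensional (`dim_E V = n ≥ 1`). Our bookkeeping. [cite: Liu2021, App. C l. 4558] -/
instance moduleFinite : Module.Finite E V.V :=
  Module.finite_of_finrank_pos (by rw [V.finrank_eq]; exact V.one_le_n)

/-- A basis `e_1, …, e_n` of `V` over `E` (exists since `dim_E V = n`; READING R4: coordinates).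
[cite: Liu2021, App. C l. 4558] -/
def basis : Module.Basis (Fin V.n) E V.V := Module.finBasisOfFinrankEq E V.V V.finrank_eq

/-- **The Gram matrix `J` of `V`** in the basis `e`: `J i j := (e_j, e_i)_V`, so that in coordinates
`(x, y)_V = Σ_{i,j} c(y_i) J_{ij} x_j = \bar yᵀ J x`, `(c J)ᵀ = J`, and `g` is an isometry iff `(c g)ᵀ J g = J` — the
convention of the tree's `unitaryGroupOfForm` / `UnitaryScheme.points` (READING R4). [cite: Liu2021, App. C l. 4558] -/
def gram : Matrix (Fin V.n) (Fin V.n) E := Matrix.of fun i j => V.form (V.basis j) (V.basis i)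

/-- `τ`-positivity of the `c`-invariant element `(x, x)_V` for `τ ∈ Φ_F`, read through the trace:
`τ (Tr_{E/F} (x, x)_V) = 2 · τ((x, x)_V) > 0` (READING R5). [cite: Liu2021, App. C l. 4558] -/
def IsPosAt (τ : F →+* ℝ) (x : V.V) : Prop := 0 < τ (Algebra.trace F E (V.form x x))

/-- `τ`-negativity of `(x, x)_V` (READING R5). [cite: Liu2021, App. C l. 4558] -/
def IsNegAt (τ : F →+* ℝ) (x : V.V) : Prop := τ (Algebra.trace F E (V.form x x)) < 0

/-- `p_τ`: the largest dimension of an `E`-subspace of `V` on which `( , )_V` is `τ`-positive definite (READING R5).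
[cite: Liu2021, App. C l. 4558] -/
def posIndex (τ : F →+* ℝ) : ℕ :=
  sSup {k : ℕ | ∃ W : Submodule E V.V, Module.finrank E W = k ∧ ∀ x ∈ W, x ≠ 0 → V.IsPosAt τ x}

/-- `q_τ`: the largest dimension of an `E`-subspace of `V` on which `( , )_V` is `τ`-negative definite (READING R5).
[cite: Liu2021, App. C l. 4558] -/
def negIndex (τ : F →+* ℝ) : ℕ :=
  sSup {k : ℕ | ∃ W : Submodule E V.V, Module.finrank E W = k ∧ ∀ x ∈ W, x ≠ 0 → V.IsNegAt τ x}

/-- **«`(p_τ, q_τ)`, the signature of `V ⊗_{F,τ} ℝ`»** for `τ ∈ Φ_F` (l. 4558; READING R5). [cite: Liu2021, App. C l. 4558] -/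
def sig (τ : F →+* ℝ) : ℕ × ℕ := (V.posIndex τ, V.negIndex τ)

/-! ### The display (C.1) (l. 4559–4562) and Definition C.1 (l. 4565–4567) -/

/-- **`sig_{V,Φ} := Σ_{τ ∈ Φ_F} p_τ τ^+ + Σ_{τ ∈ Φ_F} q_τ τ^-` in `ℕ[Φ_E]`** (display (C.1), l. 4559–4562), for a CM type
`Φ`, with `τ^+ = CMType.aboveConj Φ τ`, `τ^- = CMType.above Φ τ` (l. 4563); `p_τ τ^+` = the element of `ℕ[Φ_E]` with the
single coefficient `p_τ` at `τ^+`. [cite: Liu2021, App. C (C.1) l. 4559–4562] -/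
def sigElt (Φ : CMType E) : (E →+* ℂ) →₀ ℕ :=
  ∑ τ : F →+* ℝ, Finsupp.single (CMType.aboveConj F E Φ τ) (V.sig τ).1 +
    ∑ τ : F →+* ℝ, Finsupp.single (CMType.above F E Φ τ) (V.sig τ).2

/-- **`sig^♭_{V,Φ} := Σ_{τ ∈ Φ_F} q_τ τ^-` in `ℕ[Φ_E]`** (display (C.1), l. 4559–4562). [cite: Liu2021, App. C (C.1) l. 4559–4562] -/
def sigFlatElt (Φ : CMType E) : (E →+* ℂ) →₀ ℕ :=
  ∑ τ : F →+* ℝ, Finsupp.single (CMType.above F E Φ τ) (V.sig τ).2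

/-- **[Liu2021, Definition C.1] — the reflex field `E_{V,Φ}` of the pair `(V, Φ)`** EXACTLY AS PRINTED (l. 4565–4567):
«the fixed field of the stabilizer in `Gal(ℂ/ℚ)` of the element `sig_{V,Φ}`», an intermediate field of `ℂ/ℚ`
(Mathlib `IntermediateField.fixedField`; `Gal(ℂ/ℚ)` = `ℂ ≃ₐ[ℚ] ℂ`). [cite: Liu2021, Def. C.1 (l. 4565–4567)] -/
def reflexField (Φ : CMType E) : IntermediateField ℚ ℂ :=
  IntermediateField.fixedField (stabilizer E (V.sigElt Φ))

/-- **[Liu2021, Definition C.1] — the reduced reflex field `E^♭_{V,Φ}` of the pair `(V, Φ)`** EXACTLY AS PRINTED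
(l. 4565–4567): «the fixed field of the stabilizer in `Gal(ℂ/ℚ)` of the element `sig^♭_{V,Φ}`».
[cite: Liu2021, Def. C.1 (l. 4565–4567)] -/
def reducedReflexField (Φ : CMType E) : IntermediateField ℚ ℂ :=
  IntermediateField.fixedField (stabilizer E (V.sigFlatElt Φ))

/-- Unfolding of Def. C.1: `z ∈ E_{V,Φ}` iff every `σ ∈ Gal(ℂ/ℚ)` stabilising `sig_{V,Φ}` fixes `z`.
[cite: Liu2021, Def. C.1 (l. 4565–4567)] -/
theorem mem_reflexField_iff (Φ : CMType E) (z : ℂ) :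
    z ∈ V.reflexField Φ ↔ ∀ σ ∈ stabilizer E (V.sigElt Φ), σ z = z :=
  IntermediateField.mem_fixedField_iff _ z

/-- Unfolding of Def. C.1 for `E^♭_{V,Φ}`. [cite: Liu2021, Def. C.1 (l. 4565–4567)] -/
theorem mem_reducedReflexField_iff (Φ : CMType E) (z : ℂ) :
    z ∈ V.reducedReflexField Φ ↔ ∀ σ ∈ stabilizer E (V.sigFlatElt Φ), σ z = z :=
  IntermediateField.mem_fixedField_iff _ z

/-! ### `U(V)`, `G := Res_{F/ℚ} U(V)`, `G(𝔸^∞)` (l. 4569–4573, 4579, 4599) -/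

/-- **`U(V)(R)` for an `F`-algebra `R`** (l. 4569–4571: «`U(V)(R) = {g ∈ GL_R(V ⊗_F R) | (gx, gy)_V = (x, y)_V for all
x, y ∈ V ⊗_F R}`»): in the coordinates of `basis`, `GL_R(V ⊗_F R) = GL_n(E ⊗_F R)` and the condition is
`((c ⊗ 1) g)ᵀ (J ⊗ 1) g = J ⊗ 1` — the tree's functor-of-points `UnitaryScheme.points` at `(c, J)` (READING R4).
[cite: Liu2021, App. C l. 4569–4571] -/
abbrev unitaryGroup (R : Type) [CommRing R] [Algebra F R] : Subgroup (GL (Fin V.n) (E ⊗[F] R)) :=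
  UnitaryScheme.points F E ((conj F E : E ≃ₐ[F] E) : E →ₐ[F] E) (Fin V.n) V.gram R

/-- **`U(V)` as a group over `F` through its functor of points `R ↦ U(V)(R)` on commutative `F`-algebras** (l. 4569:
«the reductive group over `F` such that for every `F`-algebra `R`, we have `U(V)(R) = …`»); the tree's
`UnitaryScheme.functor`.  Reductivity is not typed. [cite: Liu2021, App. C l. 4569–4571] -/
abbrev unitaryGroupFunctor : CommAlgCat.{0} F ⥤ GrpCat.{0} :=
  UnitaryScheme.functor F E ((conj F E : E ≃ₐ[F] E) : E →ₐ[F] E) (Fin V.n) V.gram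

/-- The rational points `U(V)(F) = {g ∈ GL_n(E) | (c g)ᵀ J g = J}` (the tree's `unitaryGroupOfForm`; cf.
`UnitaryScheme.pointsSelfEquiv`). [cite: Liu2021, App. C l. 4569–4571] -/
abbrev rationalPoints : Subgroup (GL (Fin V.n) E) := unitaryGroupOfForm (conj F E : E →+* E) V.gram

/-- **`G := Res_{F/ℚ} U(V)`** (l. 4579), through its functor of points on commutative `ℚ`-algebras:
`G(A) = U(V)(F ⊗_ℚ A)` (Weil restriction of scalars). [cite: Liu2021, App. C l. 4579] -/
abbrev resPoints (A : Type) [CommRing A] [Algebra ℚ A] : Subgroup (GL (Fin V.n) (E ⊗[F] (F ⊗[ℚ] A))) :=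
  V.unitaryGroup (F ⊗[ℚ] A)

/-- **`G(𝔸^∞) = U(V)(𝔸_F^∞)`** (l. 4599), the group indexing the Shimura varieties: the finite-adèlic points
`{g ∈ GL_n(𝔸_E^∞) | ((c ⊗ 1) g)ᵀ J g = J}` — the tree's `UnitaryGroup.finAdelic` (READING R6: `E ⊗_F 𝔸_F^∞ = 𝔸_E^∞`),
a topological group (subspace topology of `GL_n(𝔸_E^∞)`). [cite: Liu2021, App. C l. 4599] -/
abbrev Gfin : Subgroup (GL (Fin V.n) (IsDedekindDomain.FiniteAdeleRing (𝓞 E) E)) :=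
  UnitaryGroup.finAdelic F E (conj F E) V.n V.gram

/-! ### The Hodge map `h^♭_{V,Φ}` (l. 4579–4598) and Remark C.2's `h_{V,τ'}` -/

/-- **The Hodge map `h^♭_{V,Φ}` on real points** (l. 4579–4598): «sending `z ∈ ℂ^× = (Res_{ℂ/ℝ} 𝔾_m)(ℝ)` to
`(diag(I_{p_{τ_1}}, (z/\bar z) I_{q_{τ_1}}), …, diag(I_{p_{τ_d}}, (z/\bar z) I_{q_{τ_d}})) ∈ G_ℝ(ℝ)`, where we identify
`G_ℝ(ℝ)` as a subgroup of `GL_n(ℂ)^d` via `{τ_1^-, …, τ_d^-}`» — typed as exactly that tuple of matrices, indexed by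
`τ ∈ Φ_F` (equivalently by `τ^- ∈ Φ`), the `τ`-th in the printed coordinates `V ⊗_{E,τ^-} ℂ = ℂ^{⊕n}` of l. 4573 in
which the form is `diag(I_{p_τ}, −I_{q_τ})` (READING R7: that identification is the printed one, not constructed here;
`p_τ + q_τ = n` by non-degeneracy). [cite: Liu2021, App. C l. 4579–4598] -/
def hodgeMapFlat (z : ℂˣ) (τ : F →+* ℝ) : Matrix (Fin ((V.sig τ).1 + (V.sig τ).2)) (Fin ((V.sig τ).1 + (V.sig τ).2)) ℂ :=
  diagPQ (V.sig τ).1 (V.sig τ).2 ((z : ℂ) / starRingEnd ℂ (z : ℂ))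

/-- **The hypothesis of Remark C.2** (l. 4603): «there is an element `τ ∈ Φ_F` such that `V` has signature `(n−1, 1)` at
`τ` and `(n, 0)` at other places». [cite: Liu2021, Rem. C.2 (l. 4603)] -/
def IsSignatureN1At (τ : F →+* ℝ) : Prop :=
  V.sig τ = (V.n - 1, 1) ∧ ∀ τ₀ : F →+* ℝ, τ₀ ≠ τ → V.sig τ₀ = (V.n, 0)

/-- **`h_{V,τ'}`** (Rem. C.2, l. 4603: for `V` of signature `(n−1,1)` at `τ` and `(n,0)` elsewhere the Hodge map
«depend[s] only on `Φ ∩ π^{−1}τ`»; «for an element `τ' ∈ Φ_E` above `τ`, we may write `h_{V,τ'}`»): its only non-scalar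
component, the `τ`-th, `z ↦ diag(I_{n−1}, z/\bar z)` in the printed coordinates at `τ' = τ^-` (READING R7); the other
components are `I_n`. [cite: Liu2021, Rem. C.2 (l. 4603)] -/
def hodgeMap (_τ' : E →+* ℂ) (z : ℂˣ) : Matrix (Fin (V.n - 1 + 1)) (Fin (V.n - 1 + 1)) ℂ :=
  diagPQ (V.n - 1) 1 ((z : ℂ) / starRingEnd ℂ (z : ℂ))

/-! ### The Shimura varieties of isometry type (l. 4599) and of Remark C.2 — ⟨CARRIER⟩ structures -/

/-- ⟨CARRIER⟩ **«a projective system of schemes `{Sh(G, h^♭_{V,Φ})_K}_K`, quasi-projective and smooth over `E^♭_{V,Φ}` of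
dimension `Σ_{τ ∈ Φ_F} p_τ q_τ`, indexed by neat open compact subgroups `K` of `G(𝔸^∞) = U(V)(𝔸_F^∞)`»** (l. 4599), for the
Shimura datum `(G, h^♭_{V,Φ})` («of abelian type but not Hodge type; and its reflex field coincides with `E^♭_{V,Φ}`» —
printed claims, recorded, not typed).  The schemes and transition maps are posited data over the REAL base field
`E^♭_{V,Φ} = V.reducedReflexField Φ` and the REAL group `G(𝔸^∞) = V.Gfin`; «neat» is a posited predicate (READING R8);
the printed attributes are `Prop` fields on REAL predicates.  Nothing is asserted; a consumer supplies the datum.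
[cite: Liu2021, App. C l. 4599] -/
structure ShimuraSystemFlat (Φ : CMType E) : Type 1 where
  /-- ⟨CARRIER⟩ «neat» open compact subgroups of `G(𝔸^∞)` (l. 4599; not defined in [Liu2021]). -/
  IsNeat : Subgroup V.Gfin → Prop
  /-- ⟨CARRIER⟩ `K ↦ Sh(G, h^♭_{V,Φ})_K`, a scheme over `E^♭_{V,Φ}` (meaningful for neat open compact `K`). -/
  Sh : Subgroup V.Gfin → SchemeOver (V.reducedReflexField Φ)
  /-- ⟨CARRIER⟩ the transition maps of the projective system, `K' ≤ K ↦ (Sh_{K'} → Sh_K)`. -/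
  tr : ∀ {K K' : Subgroup V.Gfin}, K' ≤ K → (Sh K' ⟶ Sh K)
  /-- projective system: identity. -/
  tr_refl : ∀ K : Subgroup V.Gfin, tr (le_refl K) = 𝟙 (Sh K)
  /-- projective system: composition. -/
  tr_trans : ∀ {K K' K'' : Subgroup V.Gfin} (h' : K'' ≤ K') (h : K' ≤ K), tr (h'.trans h) = tr h' ≫ tr h
  /-- «quasi-projective … over `E^♭_{V,Φ}`» (l. 4599), for neat open compact `K`. -/
  quasiProjective : ∀ K, IsNeat K → IsOpen (K : Set V.Gfin) → IsCompact (K : Set V.Gfin) →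
    IsQuasiProjectiveOver (Sh K)
  /-- «smooth over `E^♭_{V,Φ}` of dimension `Σ_{τ ∈ Φ_F} p_τ q_τ`» (l. 4599), for neat open compact `K`. -/
  smooth_dim : ∀ K, IsNeat K → IsOpen (K : Set V.Gfin) → IsCompact (K : Set V.Gfin) →
    SmoothOfRelativeDimension (∑ τ : F →+* ℝ, (V.sig τ).1 * (V.sig τ).2) (Sh K).hom

/-- ⟨CARRIER⟩ **Remark C.2's Shimura varieties `{Sh(G, h_{V,τ'})_K}_K`** (l. 4602–4603) for `V` of signature `(n−1,1)` at
`τ = π τ'` and `(n,0)` at other places (hypothesis field `sig_eq`, REAL) and `τ' ∈ Φ_E` above `τ`: the system of l. 4599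
for any CM type `Φ ∋ τ'` («we may write `h_{V,τ'}` and `Sh(G, h_{V,τ'})_K` for those `Φ` containing `τ'`»), posited as
schemes over `E` (READING R9: the printed base is the reflex field `τ'(E) ⊆ ℂ` — «the reflex field of `h_{V,τ'}` is
`τ'(E)`», l. 4603 — identified with `E` along `τ' : E ≃ τ'(E)`), of dimension `Σ p_τ q_τ = n − 1`.  NOT TYPED here (no
carrier posited; quoted in the module docstring): the dependence-only-on-`Φ ∩ π^{−1}τ` claim and the Galois action on
`π_0(Sh(G, h_{V,τ'})_K ⊗ ℂ)` via `rec`, `(τ')^{−1}`, `e ↦ e/e^c` (l. 4603–4608).  Nothing is asserted.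
[cite: Liu2021, Rem. C.2 (l. 4602–4609)] -/
structure ShimuraSystem (τ' : E →+* ℂ) : Type 1 where
  /-- «`V` has signature `(n−1, 1)` at `τ` and `(n, 0)` at other places», `τ = π τ'` (l. 4603). REAL hypothesis. -/
  sig_eq : V.IsSignatureN1At (restr F E τ')
  /-- ⟨CARRIER⟩ «neat» open compact subgroups of `G(𝔸^∞)` (l. 4599). -/
  IsNeat : Subgroup V.Gfin → Prop
  /-- ⟨CARRIER⟩ `K ↦ Sh(G, h_{V,τ'})_K`, a scheme over `τ'(E) ≅ E` (READING R9). -/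
  Sh : Subgroup V.Gfin → SchemeOver E
  /-- ⟨CARRIER⟩ transition maps `K' ≤ K ↦ (Sh_{K'} → Sh_K)`. -/
  tr : ∀ {K K' : Subgroup V.Gfin}, K' ≤ K → (Sh K' ⟶ Sh K)
  /-- projective system: identity. -/
  tr_refl : ∀ K : Subgroup V.Gfin, tr (le_refl K) = 𝟙 (Sh K)
  /-- projective system: composition. -/
  tr_trans : ∀ {K K' K'' : Subgroup V.Gfin} (h' : K'' ≤ K') (h : K' ≤ K), tr (h'.trans h) = tr h' ≫ tr h
  /-- «quasi-projective» (l. 4599), for neat open compact `K`. -/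
  quasiProjective : ∀ K, IsNeat K → IsOpen (K : Set V.Gfin) → IsCompact (K : Set V.Gfin) →
    IsQuasiProjectiveOver (Sh K)
  /-- «smooth … of dimension `Σ p_τ q_τ`» = `n − 1` under `sig_eq` (l. 4599, 4603), for neat open compact `K`. -/
  smooth_dim : ∀ K, IsNeat K → IsOpen (K : Set V.Gfin) → IsCompact (K : Set V.Gfin) →
    SmoothOfRelativeDimension (V.n - 1) (Sh K).hom

end HermSpace

/-! ## Definition C.3 (l. 4614–4616) and l. 4618: incoherent hermitian spaces over `𝔸_E`, `𝔾 := U(𝕍)` -/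

/-- **[Liu2021, Definition C.3] — incoherent hermitian space over `𝔸_E`** EXACTLY AS PRINTED (l. 4614–4616): «a free
`𝔸_E`-module `𝕍` of some rank `n ≥ 1`, equipped with a non-degenerate hermitian form `( , )_𝕍 : 𝕍 × 𝕍 → 𝔸_E` with respect
to the (induced) involution `c` on `𝔸_E` such that its determinant belongs to `𝔸_F^× ∖ F^× Nm_{𝔸_E/𝔸_F} 𝔸_E^×`».  REAL on
Mathlib's `𝔸_E = AdeleRing (𝓞 E) E`, `𝔸_F = AdeleRing (𝓞 F) F`, the tree's `c ⊗ 1 = UnitaryGroup.conjAdele F E c` and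
`AdeleRing.baseChange F E : 𝔸_F → 𝔸_E`; the basis is carried as data (READING R4) and «its determinant» is the Gram
determinant `det ((e_j, e_i)_𝕍)_{i,j}` in that basis (the printed condition is basis-invariant).  Nothing is asserted.
[cite: Liu2021, Def. C.3 (l. 4614–4616)] -/
structure IncoherentHermSpace : Type 1 where
  /-- The underlying `𝔸_E`-module `𝕍`. -/
  𝕍 : Type
  [instAddCommGroup : AddCommGroup 𝕍]
  [instModule : Module (AdeleRing (𝓞 E) E) 𝕍]
  /-- «of some rank `n`» (l. 4614). -/
  n : ℕ
  /-- «`n ≥ 1`» (l. 4614). -/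
  one_le_n : 1 ≤ n
  /-- «a free `𝔸_E`-module … of rank `n`» (l. 4614): a basis `e_1, …, e_n` over `𝔸_E` (READING R4). -/
  basis : Module.Basis (Fin n) (AdeleRing (𝓞 E) E) 𝕍
  /-- «hermitian form `( , )_𝕍 : 𝕍 × 𝕍 → 𝔸_E`» (l. 4615). -/
  form : 𝕍 → 𝕍 → AdeleRing (𝓞 E) E
  /-- additivity in the first variable. -/
  form_add_left : ∀ x y z : 𝕍, form (x + y) z = form x z + form y z
  /-- `𝔸_E`-linearity in the first variable (a hermitian form, as for `V`, l. 4558). -/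
  form_smul_left : ∀ (a : AdeleRing (𝓞 E) E) (x y : 𝕍), form (a • x) y = a * form x y
  /-- «hermitian … with respect to the (induced) involution `c` on `𝔸_E`» (l. 4615): `(y, x)_𝕍 = (c ⊗ 1)((x, y)_𝕍)`. -/
  form_herm : ∀ x y : 𝕍, form y x = UnitaryGroup.conjAdele F E (conj F E) (form x y)
  /-- «non-degenerate» (l. 4615) over the ring `𝔸_E`: the Gram determinant `det ((e_j, e_i)_𝕍)` is a unit of `𝔸_E`. -/
  form_nondeg : IsUnit (Matrix.det (Matrix.of fun i j : Fin n => form (basis j) (basis i)))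
  /-- «its determinant belongs to `𝔸_F^×`» (l. 4615): the Gram determinant is (the image in `𝔸_E` of) an idèle of `F`. -/
  det_mem : ∃ a : (AdeleRing (𝓞 F) F)ˣ,
    AdeleRing.baseChange F E (a : AdeleRing (𝓞 F) F) = Matrix.det (Matrix.of fun i j : Fin n => form (basis j) (basis i))
  /-- «… `∖ F^× Nm_{𝔸_E/𝔸_F} 𝔸_E^×`» (l. 4615): the Gram determinant is NOT of the form `f · Nm(z) = f · z · c(z)` with
  `f ∈ F^×` (embedded diagonally, `F → E → 𝔸_E`) and `z ∈ 𝔸_E^×` — the INCOHERENCE condition. -/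
  det_not_mem : ¬ ∃ (f : Fˣ) (z : (AdeleRing (𝓞 E) E)ˣ),
    Matrix.det (Matrix.of fun i j : Fin n => form (basis j) (basis i)) =
      algebraMap E (AdeleRing (𝓞 E) E) (algebraMap F E (f : F)) *
        ((z : AdeleRing (𝓞 E) E) * UnitaryGroup.conjAdele F E (conj F E) (z : AdeleRing (𝓞 E) E))

attribute [instance] IncoherentHermSpace.instAddCommGroup IncoherentHermSpace.instModule

namespace IncoherentHermSpace

variable {F E}
variable (𝕍 : IncoherentHermSpace F E)

/-- **The Gram matrix of `𝕍`** in its basis: `J i j := (e_j, e_i)_𝕍 ∈ 𝔸_E` (same convention as `HermSpace.gram`,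
READING R4). [cite: Liu2021, Def. C.3 (l. 4614–4616)] -/
def gram : Matrix (Fin 𝕍.n) (Fin 𝕍.n) (AdeleRing (𝓞 E) E) := Matrix.of fun i j => 𝕍.form (𝕍.basis j) (𝕍.basis i)

/-- «its determinant» (l. 4615) is `det J`. [cite: Liu2021, Def. C.3 (l. 4615)] -/
theorem isUnit_det_gram : IsUnit 𝕍.gram.det := 𝕍.form_nondeg

/-- The finite-adèlic part `J^∞ ∈ M_n(𝔸_E^∞)` of the Gram matrix (`𝔸_E = E_∞ × 𝔸_E^∞` in Mathlib).
[cite: Liu2021, Def. C.3 (l. 4614–4616)] -/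
def finGram : Matrix (Fin 𝕍.n) (Fin 𝕍.n) (IsDedekindDomain.FiniteAdeleRing (𝓞 E) E) :=
  𝕍.gram.map fun x : AdeleRing (𝓞 E) E => x.2

/-- The archimedean component of the Gram matrix at an infinite place `w` of `E`, read in `ℂ` through Mathlib's
`InfinitePlace.Completion.extensionEmbedding w : E_w →+* ℂ` (READING R5'). [cite: Liu2021, Def. C.3 (l. 4616)] -/
def archGram (w : InfinitePlace E) : Matrix (Fin 𝕍.n) (Fin 𝕍.n) ℂ :=
  Matrix.of fun i j => InfinitePlace.Completion.extensionEmbedding w ((𝕍.gram i j).1 w)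

/-- **«`𝕍` is totally positive definite if for every `τ ∈ Φ_F`, `𝕍 ⊗_{𝔸_F,τ} ℝ` is positive definite»** (Def. C.3,
l. 4616): for every real embedding `τ` of `F` and the infinite place `w` of `E` above it, the `w`-component of the Gram
matrix is positive definite (Mathlib `Matrix.PosDef`: hermitian and `\bar xᵀ J_w x > 0` for `x ≠ 0` — the form
`(x, x)_𝕍 = \bar xᵀ J x` of READING R4) (READING R5': `𝕍 ⊗_{𝔸_F,τ} ℝ` is the `w`-component `𝕍_w`, a hermitian space over
`E_w ≅ ℂ`). [cite: Liu2021, Def. C.3 (l. 4616)] -/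
def IsTotallyPositiveDefinite (𝕍 : IncoherentHermSpace F E) : Prop :=
  ∀ (τ : F →+* ℝ) (w : InfinitePlace E),
    w.comap (algebraMap F E) = InfinitePlace.mk (Complex.ofRealHom.comp τ) → (𝕍.archGram w).PosDef

/-- **`𝔾 := U(𝕍)`, «its group of isometry, which is a reductive group over `𝔸_F`»** (l. 4618) — its `𝔸_F`-points
`𝔾(𝔸_F) = {g ∈ GL_n(𝔸_E) | ((c ⊗ 1) g)ᵀ J g = J}` (the tree's `unitaryGroupOfForm` for `c ⊗ 1 = UnitaryGroup.conjAdele`;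
READING R4).  Reductivity is not typed. [cite: Liu2021, App. C l. 4618] -/
abbrev Gadelic : Subgroup (GL (Fin 𝕍.n) (AdeleRing (𝓞 E) E)) :=
  unitaryGroupOfForm (UnitaryGroup.conjAdele F E (conj F E)) 𝕍.gram

/-- **`𝔾(𝔸_F^∞)`**, the finite-adèlic points of `𝔾 = U(𝕍)` (l. 4618; the group whose «sufficiently small open compact
subgroups `K`» index `{Sh(𝕍)_K}_K`, Prop. C.5 l. 4628 and §4.2 l. 2060): `{g ∈ GL_n(𝔸_E^∞) | ((c ⊗ 1) g)ᵀ J^∞ g = J^∞}`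
(the tree's `unitaryGroupOfForm` for `UnitaryGroup.conjFiniteAdele`), a topological group (subspace topology of
`GL_n(𝔸_E^∞)`). [cite: Liu2021, App. C l. 4618] -/
abbrev Gfin : Subgroup (GL (Fin 𝕍.n) (IsDedekindDomain.FiniteAdeleRing (𝓞 E) E)) :=
  unitaryGroupOfForm (UnitaryGroup.conjFiniteAdele F E (conj F E)) 𝕍.finGram

end IncoherentHermSpace

end Literature.NumberTheory.Automorphic.Liu2021.AppendixC

end
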